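import Summits.KontsevichZagierPeriods.KontsevichZagierPeriods.Theorems.LinRedNormalFormArrangementNormalFormSeparateThreeHHKSecI

/-!
# The sector theorems without graded data: regular points and the wall invariant

(Line `janus-bands`, crux `ArrangementNormalForm`, stub `stub_separateHigh`, part `HHKSecAway` of
the wall-invariant termwise-split lemma `separateThree_hHk` in base dimension `3` with fibres.)
Two sector theorems for the density `g = 𝟙_Y (∑ |Ri i|) m` of the Taylor pieces:
* `sector_away` (registered as `separateThreeHHK_secAway`): at a base point `z₁` where the common
  denominator does not vanish (no wall through `z₁`), every nested sector has finite mass for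
  small scales — the weight `wt3 0 0 0 |common ∘ npt| (m ∘ npt)` has logarithmic cost in all three
  variables, so `SepHHK.ray_order3` + `SepHHK.reduce_t` integrate the weight itself, which
  dominates the (bounded) pieces;
* `sector_null`: at a base point `z₁` of the pole plane, a direction `d` transversal to the pole
  plane but contained in an active letter plane through `z₁` spans only NULL sectors — a sector
  inside `Y` would put the open ray `z₁ + t d` into `closure Y`, where the wall invariant `hH`
  (an active letter vanishing on `closure Y` forces the pole plane) is violated.
-/

noncomputable section

open Set MeasureTheory Filter Topology
open scoped ENNReal

namespace Summit.KontsevichZagierPeriods.ArrangementNormalForm.JanusBands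

namespace SepHHK

open SepTwo

/-- The `x′`-projection is continuous. -/
theorem continuous_pr2 : Continuous (pr2 : (Fin 3 → ℝ) → Fin 2 → ℝ) :=
  continuous_pi fun _ => continuous_apply _

/-- The pole coordinate is continuous. -/
theorem continuous_lam3 (l₁ l₂ l₀ : ℝ) : Continuous (lam3 l₁ l₂ l₀) := by
  unfold lam3; fun_prop

/-- The common denominator is continuous. -/
theorem continuous_common {mL : ℕ} (κ : Fin mL → Fin 2 → ℝ) (μ : Fin mL → ℝ) (e : Fin mL → ℕ)
    (n : ℕ) (l₁ l₂ l₀ : ℝ) : Continuous (common κ μ e n l₁ l₂ l₀) := by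
  unfold common lval3
  exact (continuous_finsetProd _ fun j _ => by fun_prop).mul ((continuous_lam3 l₁ l₂ l₀).pow n)

/-- **Bounded pieces near a base point.** -/
theorem exists_pieces_bound (N : ℕ) (q : ℕ → MvPolynomial (Fin 2) ℝ) (l₁ l₂ l₀ : ℝ)
    (z₁ d Q S : Fin 3 → ℝ) :
    ∃ CF : ℝ, 0 ≤ CF ∧ ∀ i < N, ∀ t ∈ Icc (0 : ℝ) 1, ∀ v ∈ Icc (0 : ℝ) 1,
      ∀ u ∈ Icc (0 : ℝ) 1, |MvPolynomial.eval (pr2 (npt z₁ d Q S t v u)) (q i) *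
        lam3 l₁ l₂ l₀ (npt z₁ d Q S t v u) ^ i| ≤ CF := by
  set f : ℝ × ℝ × ℝ → ℝ := fun p => ∑ i ∈ Finset.range N,
    |MvPolynomial.eval (pr2 (npt z₁ d Q S p.1 p.2.1 p.2.2)) (q i) *
      lam3 l₁ l₂ l₀ (npt z₁ d Q S p.1 p.2.1 p.2.2) ^ i| with hf
  have hfc : Continuous f := by
    refine continuous_finsetSum _ fun i _ => Continuous.abs ?_
    exact ((MvPolynomial.continuous_eval (q i)).comp (continuous_pr2.comp
      (continuous_npt z₁ d Q S))).mul (((continuous_lam3 l₁ l₂ l₀).comp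
      (continuous_npt z₁ d Q S)).pow i)
  have hK : IsCompact ((Icc (0 : ℝ) 1) ×ˢ ((Icc (0 : ℝ) 1) ×ˢ (Icc (0 : ℝ) 1))) :=
    isCompact_Icc.prod (isCompact_Icc.prod isCompact_Icc)
  obtain ⟨B, hB⟩ := hK.exists_bound_of_continuousOn hfc.continuousOn
  refine ⟨max B 0, le_max_right _ _, fun i hi t ht v hv u hu => ?_⟩
  have h := hB (t, v, u) ⟨ht, hv, hu⟩
  rw [Real.norm_eq_abs, abs_of_nonneg (Finset.sum_nonneg fun _ _ => abs_nonneg _)] at h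
  refine le_trans ?_ (h.trans (le_max_left _ _))
  exact Finset.single_le_sum (f := fun i' => |MvPolynomial.eval (pr2 (npt z₁ d Q S t v u)) (q i') *
    lam3 l₁ l₂ l₀ (npt z₁ d Q S t v u) ^ i'|) (fun _ _ => abs_nonneg _) (Finset.mem_range.2 hi)

/-- Two-sided bounds near the corner for a continuous function of `(t, v, u)` not vanishing at
the corner. -/
theorem exists_corner_bounds (f : ℝ × ℝ × ℝ → ℝ) (hfc : Continuous f) (hf0 : f 0 ≠ 0) :
    ∃ ωlo > 0, ∃ ωhi : ℝ, ∃ ρ > 0, ∀ t v u : ℝ, |t| < ρ → |v| < ρ → |u| < ρ →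
      ωlo ≤ |f (t, v, u)| ∧ |f (t, v, u)| ≤ ωhi := by
  have hpos : 0 < |f 0| / 2 := half_pos (abs_pos.2 hf0)
  obtain ⟨ρ, hρ, hb⟩ := Metric.continuousAt_iff.1 hfc.continuousAt (|f 0| / 2) hpos
  refine ⟨|f 0| / 2, hpos, |f 0| + |f 0| / 2, ρ, hρ, fun t v u ht hv hu => ?_⟩
  have hd : dist ((t, v, u) : ℝ × ℝ × ℝ) 0 < ρ := by
    rw [Prod.dist_eq, Prod.dist_eq]
    simp only [Prod.fst_zero, Prod.snd_zero, Real.dist_eq, sub_zero]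
    exact max_lt ht (max_lt hv hu)
  have h := hb hd
  rw [Real.dist_eq] at h
  have h1 := abs_sub_abs_le_abs_sub (f (t, v, u)) (f 0)
  have h2 := abs_sub_abs_le_abs_sub (f 0) (f (t, v, u))
  rw [abs_sub_comm] at h2
  exact ⟨by linarith, by linarith⟩

/-- **The sector theorem at a regular point.** See the module docstring. -/
theorem sector_away {k mL m'' : ℕ} (φ : Fin m'' → (Fin 3 → ℝ) × ℝ)
    (lo hi : Fin k → Fin k ⊕ Atm 3) (a : Fin k → Option (Atm 3))
    (κ : Fin mL → Fin 2 → ℝ) (μ : Fin mL → ℝ) (e : Fin mL → ℕ) (n : ℕ) (l₁ l₂ l₀ : ℝ)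
    (N : ℕ) (q : ℕ → MvPolynomial (Fin 2) ℝ) (R : (Fin 3 → ℝ) → ℝ) (Ri : ℕ → (Fin 3 → ℝ) → ℝ)
    (z₁ : Fin 3 → ℝ)
    (hR : ∀ x, R x = (∑ i ∈ Finset.range N, MvPolynomial.eval (pr2 x) (q i) * lam3 l₁ l₂ l₀ x ^ i) /
      common κ μ e n l₁ l₂ l₀ x)
    (hRi : ∀ i < N, ∀ x, Ri i x = MvPolynomial.eval (pr2 x) (q i) * lam3 l₁ l₂ l₀ x ^ i /
      common κ μ e n l₁ l₂ l₀ x)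
    (hRm : Measurable R) (hRim : ∀ i, Measurable (Ri i))
    (hfinY : ∫⁻ x in {x | ∀ j, 0 < rav x (φ j)}, ENNReal.ofReal |R x| * lmass lo hi a (av x) < ∞)
    {D : ℕ} (c : Coef₃ D) (hc : c ≠ 0)
    (hF : ∀ ξ : Fin 3 → ℝ, (∑ i ∈ Finset.range N, MvPolynomial.eval (pr2 (z₁ + ξ)) (q i) *
      lam3 l₁ l₂ l₀ (z₁ + ξ) ^ i) = Fnum l₁ l₂ c ξ)
    (d Q S : Fin 3 → ℝ) (hdet : det3 d Q S ≠ 0) (hreg : common κ μ e n l₁ l₂ l₀ z₁ ≠ 0) :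
    ∀ᶠ δt in 𝓝[>] (0 : ℝ), ∀ᶠ δ in 𝓝[>] (0 : ℝ), ∀ᶠ ε in 𝓝[>] (0 : ℝ),
      ∫⁻ z in nsector z₁ d Q S δt δ (Ico 0 ε), {x : Fin 3 → ℝ | ∀ j, 0 < rav x (φ j)}.indicator
        (fun x => (∑ i ∈ Finset.range N, ENNReal.ofReal |Ri i x|) * lmass lo hi a (av x)) z < ∞ := by
  set Y : Set (Fin 3 → ℝ) := {x | ∀ j, 0 < rav x (φ j)} with hY
  have hYm : MeasurableSet Y := measurableSet_Y3 φ
  set mm : (Fin 3 → ℝ) → ℝ≥0∞ := fun x => lmass lo hi a (av x) with hmm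
  have hm : Measurable mm := measurable_lmass_av lo hi a
  -- the regular factor: the common denominator itself
  set ω : ℝ → ℝ → ℝ → ℝ := fun t v u => common κ μ e n l₁ l₂ l₀ (npt z₁ d Q S t v u) with hω
  have hωc : Continuous fun p : ℝ × ℝ × ℝ => ω p.1 p.2.1 p.2.2 :=
    (continuous_common κ μ e n l₁ l₂ l₀).comp (continuous_npt z₁ d Q S)
  have hωm : Measurable fun p : ℝ × ℝ × ℝ => ω p.1 p.2.1 p.2.2 := hωc.measurable
  have hω0 : (fun p : ℝ × ℝ × ℝ => ω p.1 p.2.1 p.2.2) 0 ≠ 0 := by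
    have hnpt : npt z₁ d Q S 0 0 0 = z₁ := by funext i; simp [npt]
    simp only [hω, Prod.fst_zero, Prod.snd_zero, hnpt]; exact hreg
  obtain ⟨ωlo, hωlo, ωhi, ρ, hρ, hωb⟩ := exists_corner_bounds _ hωc hω0
  -- weight data, pieces bound, order data
  obtain ⟨δ₀, hδ₀, ε₀, hε₀, η₀, hη₀, KΛ, hKΛ, Kn, CΛ, hCΛ, hΛmono, hΛt, hΛv, hΛu⟩ :=
    weight_hyps3 lo hi a z₁ d Q S
  obtain ⟨CF, hCF, hFb⟩ := exists_pieces_bound N q l₁ l₂ l₀ z₁ d Q S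
  obtain ⟨a₀, ha₀, hcrow, -⟩ := exists_order3 c hc
  have hPP : PP l₁ l₂ (crow c a₀) d Q S ≠ 0 := PP_ne_zero l₁ l₂ (crow c a₀) hdet a₀
    (fun r ξ => Fnum_crow_smul l₁ l₂ c a₀ ξ r) (Fnum_ne_zero_of_coef l₁ l₂ (crow c a₀) hcrow)
  obtain ⟨v₁, hv₁, -, hdy⟩ := lower_dyadic₂ (PP l₁ l₂ (crow c a₀) d Q S) hPP
  -- sign dichotomy and scales
  have hsign := eventually_in_or_out3 φ z₁ d Q S
  have hcδt : 0 < min (min (δ₀ / 4) (ρ / 4)) 1 := by positivity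
  filter_upwards [hsign, Ioo_mem_nhdsGT hcδt] with δt hsδt hδt
  have hδtpos : 0 < δt := hδt.1
  obtain ⟨hδta, hδt1⟩ := lt_min_iff.1 hδt.2
  obtain ⟨hδt0, hδtρ⟩ := lt_min_iff.1 hδta
  have h4δt : 4 * δt ≤ δ₀ := by linarith
  have hδtδ₀ : δt ≤ δ₀ := by linarith
  have hcδ : 0 < min (min (ε₀ / 16) (ρ / 16)) (min (v₁ / 4) (1 / 4)) := by positivity
  filter_upwards [hsδt, Ioo_mem_nhdsGT hcδ] with δ hsδ hδ
  have hδpos : 0 < δ := hδ.1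
  obtain ⟨hδa, hδb⟩ := lt_min_iff.1 hδ.2
  obtain ⟨hδ0, hδρ⟩ := lt_min_iff.1 hδa
  obtain ⟨hδv, hδ1⟩ := lt_min_iff.1 hδb
  have h4δ : 4 * δ ≤ ε₀ := by linarith
  obtain ⟨η₁, hη₁, hη₁1, hdyη⟩ := hdy δ hδ.1 (by linarith)
  have hcε : 0 < min (min (η₀ / 16) (ρ / 16)) (η₁ / 4) := by positivity
  filter_upwards [hsδ, Ioo_mem_nhdsGT hcε] with ε hsε hε
  have hεpos : 0 < ε := hε.1
  obtain ⟨hεa, hεη⟩ := lt_min_iff.1 hε.2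
  obtain ⟨hε0, hερ⟩ := lt_min_iff.1 hεa
  have h4ε : 4 * ε ≤ η₀ := by linarith
  obtain ⟨h, hh, hle⟩ := hdyη ε hε.1 (by linarith)
  -- outside: no mass
  rcases hsε with hin4 | hout
  swap
  · rw [nsector_zero N z₁ d Q S hYm hm hRim hdet fun t ht v hv u hu =>
      hout t (Ioo_four hδt.1 ht) v (Ioo_four hδ.1 hv) u (Ioo_four hε.1 hu)]
    exact ENNReal.zero_lt_top
  have hin : ∀ t ∈ Ioo (0 : ℝ) δt, ∀ v ∈ Ioo (0 : ℝ) δ, ∀ u ∈ Ioo (0 : ℝ) ε,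
      npt z₁ d Q S t v u ∈ Y := fun t ht v hv u hu =>
    hin4 t (Ioo_four hδt.1 ht) v (Ioo_four hδ.1 hv) u (Ioo_four hε.1 hu)
  refine nsector_finite N z₁ d Q S hYm hm hRim hdet hin ?_
  -- the weight
  set ωa : ℝ → ℝ → ℝ → ℝ := fun t v u => |ω t v u| with hωa
  set Λ' : ℝ → ℝ → ℝ → ℝ≥0∞ := fun t v u => mm (npt z₁ d Q S t v u) with hΛ'
  set W : ℝ → ℝ → ℝ → ℝ≥0∞ := wt3 0 0 0 ωa Λ' with hW
  have hωam : Measurable fun p : ℝ × ℝ × ℝ => ωa p.1 p.2.1 p.2.2 := hωm.abs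
  have hWm : Measurable fun p : ℝ × ℝ × ℝ => W p.1 p.2.1 p.2.2 :=
    measurable_wt3 0 0 0 hωam (measurable_lmass_npt lo hi a z₁ d Q S)
  have hωB : ∀ t ∈ Ioo (0 : ℝ) (4 * δt), ∀ v ∈ Ioo (0 : ℝ) (4 * (4 * δ)), ∀ u ∈ Ioo (0 : ℝ) (4 * (4 * ε)),
      ωlo ≤ ωa t v u ∧ ωa t v u ≤ ωhi := fun t ht v hv u hu =>
    hωb t v u (by rw [abs_of_pos ht.1]; linarith [ht.2])
      (by rw [abs_of_pos hv.1]; linarith [hv.2]) (by rw [abs_of_pos hu.1]; linarith [hu.2])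
  have hωB4 : ∀ t ∈ Ioo (0 : ℝ) (4 * δt), ∀ v ∈ Ioo (0 : ℝ) (4 * δ), ∀ u ∈ Ioo (0 : ℝ) (4 * ε),
      ωlo ≤ ωa t v u ∧ ωa t v u ≤ ωhi := fun t ht v hv u hu =>
    hωB t ht v ⟨hv.1, by linarith [hv.2]⟩ u ⟨hu.1, by linarith [hu.2]⟩
  have hmonoW := wt3_mono 0 0 0 hωlo hωB4 KΛ (Λ' := Λ') (hΛmono δt δ ε h4δt h4δ h4ε)
  set K : ℝ≥0∞ := ENNReal.ofReal (4 ^ 0 * 4 ^ 0 * 4 ^ 0 * (ωhi / ωlo)) * KΛ with hK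
  have hKne : K ≠ ∞ := ENNReal.mul_ne_top ENNReal.ofReal_ne_top hKΛ
  have htlogW := wt3_tlog 0 0 0 hωlo hωB rfl Kn CΛ (Λ' := Λ') (hΛt δt (4 * δ) (4 * ε) hδtδ₀ h4δ h4ε)
  have hvlogW := wt3_vlog 0 0 0 hωlo hωB rfl Kn CΛ (Λ' := Λ') (hΛv δt (4 * δ) (4 * ε) hδtδ₀ h4δ h4ε)
  have hulogW := wt3_ulog 0 0 0 hωlo hωB rfl Kn CΛ (Λ' := Λ') (hΛu δt (4 * δ) (4 * ε) hδtδ₀ h4δ h4ε)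
  set C : ℝ≥0∞ := ENNReal.ofReal (ωhi / ωlo) * CΛ with hC
  have hCne : C ≠ ∞ := ENNReal.mul_ne_top ENNReal.ofReal_ne_top hCΛ
  -- the conversion identity on the big box
  have hden : ∀ t ∈ Ioo (0 : ℝ) (4 * δt), ∀ v ∈ Ioo (0 : ℝ) (4 * δ), ∀ u ∈ Ioo (0 : ℝ) (4 * ε),
      |common κ μ e n l₁ l₂ l₀ (npt z₁ d Q S t v u)| = t ^ 0 * ωa t v u ∧ 0 < t ^ 0 * ωa t v u := by
    intro t ht v hv u hu
    refine ⟨by rw [pow_zero, one_mul], mul_pos (pow_pos ht.1 _) ?_⟩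
    exact hωlo.trans_le (hωB4 t ht v hv u hu).1
  have hWeq : ∀ t v u, W t v u = ENNReal.ofReal (t ^ 2 * v / (t ^ 0 * ωa t v u)) * Λ' t v u :=
    fun t v u => wt3_zero_zero 0 ωa Λ' t v u
  have hconvR : ∀ t ∈ Ioo (0 : ℝ) (4 * δt), ∀ v ∈ Ioo (0 : ℝ) (4 * δ), ∀ u ∈ Ioo (0 : ℝ) (4 * ε),
      ENNReal.ofReal (t ^ 2 * v) * (ENNReal.ofReal |R (npt z₁ d Q S t v u)| * mm (npt z₁ d Q S t v u)) =
        ENNReal.ofReal |pev (fun a' : Fin (3 * D + 1) => Fnum l₁ l₂ (crow c a') (evec d Q S v u)) t| *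
          W t v u := by
    intro t ht v hv u hu
    have hnum : (∑ i ∈ Finset.range N, MvPolynomial.eval (pr2 (npt z₁ d Q S t v u)) (q i) *
        lam3 l₁ l₂ l₀ (npt z₁ d Q S t v u) ^ i) =
        pev (fun a' : Fin (3 * D + 1) => Fnum l₁ l₂ (crow c a') (evec d Q S v u)) t := by
      rw [npt_eq, hF, Fnum_smul_pev]
    rw [hR, hWeq]
    exact piece_eq_wt (by have := ht.1.le; have := hv.1.le; positivity) (by rw [hnum])
      (hden t ht v hv u hu).1 (hden t ht v hv u hu).2 _
  have hfin := hfin_of_inside3 z₁ d Q S hm hRm hfinY hdet hin4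
  rw [setLIntegral_congr_fun measurableSet_Ioo fun t ht => setLIntegral_congr_fun measurableSet_Ioo
    fun v hv => setLIntegral_congr_fun measurableSet_Ioo fun u hu => hconvR t ht v hv u hu] at hfin
  -- the ray theorem and the order reduction in `t`
  have hΦm : ∀ a' : Fin (3 * D + 1), Measurable fun p : ℝ × ℝ =>
      Fnum l₁ l₂ (crow c a') (evec d Q S p.1 p.2) := fun a' =>
    ((continuous_Fnum l₁ l₂ (crow c a')).comp (continuous_evec d Q S)).measurable
  have hle' : ∀ v ∈ Icc (2 * δ) (4 * δ), ∀ u ∈ Icc (2 * ε) (4 * ε),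
      h ≤ |Fnum l₁ l₂ (crow c a₀) (evec d Q S v u)| := fun v hv u hu => by
    rw [← evalEval_PP]; exact hle v hv u hu
  have hray := ray_order3 W hWm (fun a' v u => Fnum l₁ l₂ (crow c a') (evec d Q S v u)) hΦm K hKne
    Kn C hCne hδ.1 hε.1
    (fun v hv u hu t t' ht htt' ht't ht' => hmonoW t v u t' v u ht htt' ht't ht' hv.1 le_rfl
      (by linarith [hv.1]) hv.2 hu.1 le_rfl (by linarith [hu.1]) hu.2)
    (fun t ht u hu v v' hv hvv' hv' => hvlogW t ht.1 ht.2 u hu.1 hu.2 v v' hv hvv' hv')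
    (fun t ht v hv u u' hu huu' hu' => hulogW t ht.1 ht.2 v (by linarith [hv.1]) hv.2 u u' hu huu' hu')
    ⟨a₀, ha₀⟩ hh hle' hfin
  have hW0 := reduce_t W hWm Kn C hCne hδt.1 htlogW a₀ hray
  -- the pieces
  intro i hiR
  have hiN : i < N := Finset.mem_range.1 hiR
  have hconv : ∀ t ∈ Ioo (0 : ℝ) δt, ∀ v ∈ Ioo (0 : ℝ) δ, ∀ u ∈ Ioo (0 : ℝ) ε,
      ENNReal.ofReal (t ^ 2 * v) * (ENNReal.ofReal |Ri i (npt z₁ d Q S t v u)| * mm (npt z₁ d Q S t v u)) ≤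
        ENNReal.ofReal CF * W t v u := by
    intro t ht v hv u hu
    have ht4 := Ioo_four hδt.1 ht
    have hv4 := Ioo_four hδ.1 hv
    have hu4 := Ioo_four hε.1 hu
    rw [hRi i hiN, hWeq]
    exact piece_le_wt (by have := ht.1.le; have := hv.1.le; positivity)
      (hFb i hiN t ⟨ht.1.le, by linarith [ht.2]⟩ v ⟨hv.1.le, by linarith [hv.2]⟩ u
        ⟨hu.1.le, by linarith [hu.2, hη₁1]⟩) (hden t ht4 v hv4 u hu4).1 (hden t ht4 v hv4 u hu4).2 _
  calc ∫⁻ t in Ioo 0 δt, ∫⁻ v in Ioo 0 δ, ∫⁻ u in Ioo 0 ε, ENNReal.ofReal (t ^ 2 * v) *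
        (ENNReal.ofReal |Ri i (npt z₁ d Q S t v u)| * mm (npt z₁ d Q S t v u))
      ≤ ∫⁻ t in Ioo 0 δt, ∫⁻ v in Ioo 0 (4 * δ), ∫⁻ u in Ioo 0 (4 * ε), ENNReal.ofReal CF * W t v u := by
        refine setLIntegral_mono' measurableSet_Ioo fun t ht => ?_
        calc ∫⁻ v in Ioo 0 δ, ∫⁻ u in Ioo 0 ε, ENNReal.ofReal (t ^ 2 * v) *
              (ENNReal.ofReal |Ri i (npt z₁ d Q S t v u)| * mm (npt z₁ d Q S t v u))
            ≤ ∫⁻ v in Ioo 0 δ, ∫⁻ u in Ioo 0 (4 * ε), ENNReal.ofReal CF * W t v u := by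
              refine setLIntegral_mono' measurableSet_Ioo fun v hv => ?_
              calc ∫⁻ u in Ioo 0 ε, ENNReal.ofReal (t ^ 2 * v) *
                    (ENNReal.ofReal |Ri i (npt z₁ d Q S t v u)| * mm (npt z₁ d Q S t v u))
                  ≤ ∫⁻ u in Ioo 0 ε, ENNReal.ofReal CF * W t v u :=
                    setLIntegral_mono' measurableSet_Ioo fun u hu => hconv t ht v hv u hu
                _ ≤ ∫⁻ u in Ioo 0 (4 * ε), ENNReal.ofReal CF * W t v u :=
                    lintegral_mono_set (Ioo_subset_Ioo le_rfl (by linarith))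
          _ ≤ ∫⁻ v in Ioo 0 (4 * δ), ∫⁻ u in Ioo 0 (4 * ε), ENNReal.ofReal CF * W t v u :=
              lintegral_mono_set (Ioo_subset_Ioo le_rfl (by linarith))
    _ = ENNReal.ofReal CF * ∫⁻ t in Ioo 0 δt, ∫⁻ v in Ioo 0 (4 * δ), ∫⁻ u in Ioo 0 (4 * ε), W t v u := by
        rw [← lintegral_const_mul' _ _ ENNReal.ofReal_ne_top]
        refine lintegral_congr fun t => ?_
        rw [← lintegral_const_mul' _ _ ENNReal.ofReal_ne_top]
        refine lintegral_congr fun v => ?_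
        rw [lintegral_const_mul' _ _ ENNReal.ofReal_ne_top]
    _ < ∞ := ENNReal.mul_lt_top ENNReal.ofReal_lt_top hW0

/-- **The null sector theorem from the wall invariant.** See the module docstring. -/
theorem sector_null {k mL m'' : ℕ} (φ : Fin m'' → (Fin 3 → ℝ) × ℝ)
    (lo hi : Fin k → Fin k ⊕ Atm 3) (a : Fin k → Option (Atm 3))
    (κ : Fin mL → Fin 2 → ℝ) (μ : Fin mL → ℝ) (e : Fin mL → ℕ) (l₁ l₂ l₀ : ℝ)
    (N : ℕ) (Ri : ℕ → (Fin 3 → ℝ) → ℝ) (hRim : ∀ i, Measurable (Ri i)) (z₁ : Fin 3 → ℝ)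
    (hH : ∀ j, e j ≠ 0 → ∀ x ∈ closure {x : Fin 3 → ℝ | ∀ j, 0 < rav x (φ j)},
      lval3 κ μ j x = 0 → lam3 l₁ l₂ l₀ x = 0)
    (hlam : lam3 l₁ l₂ l₀ z₁ = 0) (d Q S : Fin 3 → ℝ) (hdet : det3 d Q S ≠ 0)
    (hd : lamL l₁ l₂ d ≠ 0) (j₀ : Fin mL) (hj₀ : j₀ ∈ thr κ μ e z₁) (hjd : klin κ j₀ d = 0) :
    ∀ᶠ δt in 𝓝[>] (0 : ℝ), ∀ᶠ δ in 𝓝[>] (0 : ℝ), ∀ᶠ ε in 𝓝[>] (0 : ℝ),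
      ∫⁻ z in nsector z₁ d Q S δt δ (Ico 0 ε), {x : Fin 3 → ℝ | ∀ j, 0 < rav x (φ j)}.indicator
        (fun x => (∑ i ∈ Finset.range N, ENNReal.ofReal |Ri i x|) * lmass lo hi a (av x)) z < ∞ := by
  set Y : Set (Fin 3 → ℝ) := {x | ∀ j, 0 < rav x (φ j)} with hY
  have hYm : MeasurableSet Y := measurableSet_Y3 φ
  have hm : Measurable fun x : Fin 3 → ℝ => lmass lo hi a (av x) := measurable_lmass_av lo hi a
  obtain ⟨hL0, he0⟩ := (Finset.mem_filter.1 hj₀).2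
  have hsign := eventually_in_or_out3 φ z₁ d Q S
  filter_upwards [hsign, self_mem_nhdsWithin] with δt hsδt hδt
  filter_upwards [hsδt, self_mem_nhdsWithin] with δ hsδ hδ
  filter_upwards [hsδ, self_mem_nhdsWithin] with ε hsε hε
  have hδt0 : 0 < δt := hδt
  have hδ0 : 0 < δ := hδ
  have hε0 : 0 < ε := hε
  rcases hsε with hin4 | hout
  · -- inside: the open ray would lie in `closure Y`, contradicting the wall invariant
    exfalso
    have ht : (2 * δt) ∈ Ioo (0 : ℝ) (4 * δt) := ⟨by linarith, by linarith⟩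
    have hP := ray_mem_closure Y z₁ d Q S (by linarith : (0 : ℝ) < 4 * δ) (by linarith : (0 : ℝ) < 4 * ε)
      hin4 ht
    have hnpt : z₁ + (2 * δt) • d = npt z₁ d Q S (2 * δt) 0 0 := by
      funext i; simp [npt]
    have hLP : lval3 κ μ j₀ (z₁ + (2 * δt) • d) = 0 := by
      rw [hnpt, lval3_npt, hL0, hjd]; ring
    have hlamP := hH j₀ he0 _ hP hLP
    rw [hnpt, lam3_npt, hlam] at hlamP
    have : (2 * δt) * lamL l₁ l₂ d = 0 := by linarith [hlamP]
    rcases mul_eq_zero.1 this with h | h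
    · linarith
    · exact hd h
  · rw [nsector_zero N z₁ d Q S hYm hm hRim hdet fun t ht v hv u hu =>
      hout t (Ioo_four hδt0 ht) v (Ioo_four hδ0 hv) u (Ioo_four hε0 hu)]
    exact ENNReal.zero_lt_top

end SepHHK

/-- **The sector theorem at a regular base point** (registered part of `stub_separateHigh`, base
dimension `3` with fibres; consequence of `SepHHK.sector_away`): where the common denominator of
the Taylor pieces does not vanish, the density of the pieces against the fibre mass has finite
integral over every nested thin sector for all small scales. -/
theorem separateThreeHHK_secAway (k mL m'' : ℕ) (φ : Fin m'' → (Fin 3 → ℝ) × ℝ) (lo hi : Fin k → Fin k ⊕ ((Fin 3 → ℚ) × ℚ)) (a : Fin k → Option ((Fin 3 → ℚ) × ℚ)) (κ : Fin mL → Fin 2 → ℝ) (μ : Fin mL → ℝ) (e : Fin mL → ℕ) (n : ℕ) (l₁ l₂ l₀ : ℝ) (N : ℕ) (q : ℕ → MvPolynomial (Fin 2) ℝ) (R : (Fin 3 → ℝ) → ℝ) (Ri : ℕ → (Fin 3 → ℝ) → ℝ) (z₁ : Fin 3 → ℝ) (hR : ∀ x, R x = (∑ i ∈ Finset.range N, MvPolynomial.eval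 (SepHHK.pr2 x) (q i) * SepHHK.lam3 l₁ l₂ l₀ x ^ i) / SepHHK.common κ μ e n l₁ l₂ l₀ x) (hRi : ∀ i < N, ∀ x, Ri i x = MvPolynomial.eval (SepHHK.pr2 x) (q i) * SepHHK.lam3 l₁ l₂ l₀ x ^ i / SepHHK.common κ μ e n l₁ l₂ l₀ x) (hRm : Measurable R) (hRim : ∀ i, Measurable (Ri i)) (hfinY : MeasureTheory.lintegral (MeasureTheory.volume.restrict {x | ∀ j, 0 < SepHHK.rav x (φ j)}) (fun x => ENNReal.ofReal |R x| * SepTwo.lmass lo hi a (SepTwo.av x)) < ⊤) (D : ℕ) (c : Fin (D + 1) → Fin (D + 1) → Fin (D + 1) → ℝ) (hc : c ≠ 0) (hF : ∀ ξ : Fin 3 → ℝ, (∑ i ∈ Finset.range N, MvPolynomial.eval (SepHHK.pr2 (z₁ + ξ)) (q i) * SepHHK.lam3 l₁ l₂ l₀ (z₁ + ξ) ^ i) = SepHHK.Fnum l₁ l₂ c ξ) (d Q S : Fin 3 → ℝ) (hdet : SepHHK.det3 d Q S ≠ 0) (hreg : SepHHK.common κ μ e n l₁ l₂ l₀ z₁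 ≠ 0) : ∀ᶠ δt in nhdsWithin (0 : ℝ) (Set.Ioi 0), ∀ᶠ δ in nhdsWithin (0 : ℝ) (Set.Ioi 0), ∀ᶠ ε in nhdsWithin (0 : ℝ) (Set.Ioi 0), MeasureTheory.lintegral (MeasureTheory.volume.restrict (SepHHK.nsector z₁ d Q S δt δ (Set.Ico 0 ε))) (fun z => {x : Fin 3 → ℝ | ∀ j, 0 < SepHHK.rav x (φ j)}.indicator (fun x => (∑ i ∈ Finset.range N, ENNReal.ofReal |Ri i x|) * SepTwo.lmass lo hi a (SepTwo.av x)) z) < ⊤ := by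
  exact SepHHK.sector_away φ lo hi a κ μ e n l₁ l₂ l₀ N q R Ri z₁ hR hRi hRm hRim hfinY c hc hF d Q S hdet hreg

end Summit.KontsevichZagierPeriods.ArrangementNormalForm.JanusBands
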